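import Summits.BirchSwinnertonDyer.BirchSwinnertonDyer.Theorems.KatoDescentPotSupersingularWildFineSelmerSupersingularCMAnchor
import Summits.BirchSwinnertonDyer.BirchSwinnertonDyer.Theorems.KatoDescentPotSupersingularWildUpperDivisionFieldFukudaDoor
import Literature.NumberTheory.EllipticCurves.FineSelmerIsotypicClassGroupCriterion
import HarnessLib

/-!
# Route `KatoDescentPotSupersingular` (rung K9, sub-rung B5 = O6 wild `p = 3`, cell `bsd-potss`): the CLASS-NUMBER form of DOOR L6 as a
# FACT-FREE per-row road — statement (A) of Coates–Sujatha at `(E, 3)` from `Δ(E)` a cube, `3 ∤ h(ℚ(E[3]))` and `E(ℚ₃)[3] = 0`, with NO named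
# fact; U₀ (`ord₃ #Ш ≤ ord₃ #Ш_an`) from the same data modulo `hKatoA hGZK hmod` only
# (seat `bsd-potss-k9-c4` g24; route-free TOOL; `--supports stmt-BirchSwinnertonDyer-19197 --as helper`)

HONEST FRAMING. THEOREMS ONLY (no definition, no named fact, no `sorry`); a DOOR, not a class theorem; nothing is booked; items 19189 / 19197 /
19942 / 19386 stay OPEN at class level (class-wide open input of record: the zeta crux 24327); Conjecture A and BSD are proved for NO class of
curves here.  WHAT IS NEW.  The cell's door L6 («(c1) `p ∤ #Gal(ℚ(E[p])/ℚ)` + (c2*)₀ + (c3*) at `p` ⟹ (A)», conjA-anchor g15 §9) is a KERNEL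
THEOREM since conjA-anchor g16/g17 (`Literature/…/EquivariantIwasawaLemma*.lean`, `…/FineSelmerIsotypicClassGroupCriterion.lean`:
`CoatesSujatha2005.conjA_of_not_dvd_card_classGroup`, 2026-08-29) — the equivariant Iwasawa lemma up the cyclotomic tower of `ℚ(E[p])` and the
`H²`-free isotypic Coates–Sujatha descent, NO named fact.  This file packages it for the K9 record lane at `p = 3` in the currency the per-row
kernel certificates already provide: (c1) from `E[3]` IRREDUCIBLE and `Δ(E)` a CUBE (`ρ̄₃` not onto, Serre §5.3; Serre's Prop. 15 ⟹
`3 ∤ #Gal(ℚ(E[3])/ℚ)`; tree `DivisionFieldFukudaDoor.not_dvd_card_aut_divisionField_three_of_Δ_eq_cube`, k9-c4 g22), (c2*)₀ from ONE displayed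
integer `3 ∤ h(ℚ(E[3]))` (`NumberField.classNumber`), (c3*) at `3` displayed in the `E[3^∞]`-currency of the Deo–Ray–Sujatha facts («no non-zero
point of `E[3^∞]` killed by `3` is fixed by the decomposition group at `3`», i.e. `E(ℚ₃)[3] = 0`).  NOTHING is required at the bad places `v ≠ 3`
(door L6, unlike Deo–Ray–Sujatha's printed (c3)), so the road serves ♯ rows (`3 ∣ Tam`) as well.

* `conjA_three_of_Δ_eq_cube_of_not_dvd_classNumber` — (A) at `(E,3)` for every cyclotomic `ℤ₃`-extension: NO named fact.
* `missingUpperBoundAt_three_of_Δ_eq_cube_of_not_dvd_classNumber` — U₀ at a K9 row (`r_an = 0`, `ClassO6 E 3`, `E[3]` irreducible) from the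
  same data, modulo the three named facts `hKatoA` (Kato 14.5 (3) fine-Selmer reading), `hGZK`, `hmod` (through k9-c4 g5's
  `WildFineSelmerSupersingularCMAnchor.missingUpperBoundAt_wild_of_conjA`).

Scope (conjA-anchor g15 L6 census × k9-c4 g7 class-group census j265757): 228 K9 U₀-ns rows have `3 ∤ h(ℚ(E[3]))` and `E(ℚ₃)[3] = 0`
(203 with the class group of the degree-16/8 field CERTIFIED by `bnfcertify`); 167 of them already carry k8t-c4 g21's fact-free Iwasawa-1956
records (`…WildUpperMuRoadThreeClassNumberRecordsNoCS01–21`, one prime above `3`); the 61 others (54 `3Ns` + 7 `3Nn`, incl. the 19942 residue rows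
100386bx1, 155142bf1, 483678bi1) get their first fact-free (A) record through THIS door (files `…WildFineSelmerClassNumberL6Records0k`).

References: [CoatesSujatha2005] Thm. 3.4, Lemma 3.8, Cor. 3.6; [DeoRaySujatha2023] Thm. 3.8/3.9 (b) (arXiv:2202.09937 pp. 9–10);
[Washington1997] §13.3 L13.14–15, Thm. 10.4; [Serre1972] §2.4 Prop. 15, §5.3; [Kato2004Asterisque] Thm. 14.5 (3), Prop. 14.16 (2).
-/

set_option autoImplicit false
set_option linter.dupNamespace false

noncomputable section

open scoped Classical NumberField
open WeierstrassCurve NumberField Field IsDedekindDomain IntermediateField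
  Literature.NumberTheory.EllipticCurves Literature.NumberTheory.EllipticCurves.Rank1Residual
  Literature.NumberTheory.EllipticCurves.Rank1Residual.Typed
  Literature.NumberTheory.GaloisRepresentations Literature.NumberTheory.SerreUniformity Literature.NumberTheory.IwasawaTheory
  Summit.BirchSwinnertonDyer.Rank1Residual Summit.BirchSwinnertonDyer.Rank1Residual.Additive
  Summit.BirchSwinnertonDyer.BirchSwinnertonDyer.Theorems

namespace Summit.BirchSwinnertonDyer.BirchSwinnertonDyer.Theorems.WildFineSelmerClassNumberL6Door

/-- **(A) at `(E, 3)` with NO named fact — door L6, class-number form.**  `E/ℚ` elliptic (`W`), `E[3]` irreducible, `Δ(E) = d³`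
(⟹ `ρ̄₃` not onto ⟹ `3 ∤ #Gal(ℚ(E[3])/ℚ)`), `3 ∤ h(ℚ(E[3]))`, and no non-zero `3`-torsion point of `E[3^∞]` fixed by the decomposition
group at `3` (`E(ℚ₃)[3] = 0`); then for every cyclotomic `ℤ₃`-extension `κ` of `ℚ` the dual fine Selmer group of `E` over `ℚ_cyc` is finitely
generated over `ℤ₃` (statement (A) of Coates–Sujatha, tree form).  One call of conjA-anchor g17's
`CoatesSujatha2005.conjA_of_not_dvd_card_classGroup` with (c1) discharged by k9-c4 g22's `not_dvd_card_aut_divisionField_three_of_Δ_eq_cube`.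
[cite: CoatesSujatha2005, §3 Thm. 3.4 and Lemma 3.8] [cite: DeoRaySujatha2023, §3 Thm. 3.9 (b) (arXiv:2202.09937 p. 10)]
[cite: Serre1972, §2.4 Prop. 15, §5.3] -/
theorem conjA_three_of_Δ_eq_cube_of_not_dvd_classNumber (W : WeierstrassCurve ℚ) [W.IsElliptic]
    (hirr : W.HasIrreducibleModPGaloisRep 3) {d : ℚ} (hΔ : W.Δ = d ^ 3)
    (hh : haveI : NumberField ↥(W.divisionField 3) := NumberField.mk
      ¬ 3 ∣ NumberField.classNumber ↥(W.divisionField 3))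
    (hc3 : ∀ v : HeightOneSpectrum (𝓞 ℚ), ((3 : ℕ) : 𝓞 ℚ) ∈ v.asIdeal →
      ∀ x : W.geomPrimaryTorsion 3, 3 • x = 0 → (∀ δ ∈ GreenbergSelmer.decomp v, δ • x = x) → x = 0)
    (κ : ZpExtension ℚ 3) (hκ : κ.IsCyclotomic) :
    ∃ (γ : absoluteGaloisGroup ℚ) (D : W.FineSelmerDualData κ γ),
      Module.Finite ℤ_[3] (RestrictScalars ℤ_[3] (IwasawaAlgebra 3) D.X) := by
  haveI : Fact (Nat.Prime 3) := ⟨Nat.prime_three⟩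
  haveI : NumberField ↥(W.divisionField 3) := NumberField.mk
  have hG : ¬ 3 ∣ Nat.card (↥(W.divisionField 3) ≃ₐ[ℚ] ↥(W.divisionField 3)) :=
    DivisionFieldFukudaDoor.not_dvd_card_aut_divisionField_three_of_Δ_eq_cube W hirr hΔ
  have hh' : ¬ 3 ∣ Nat.card (ClassGroup (𝓞 ↥(W.divisionField 3))) := by
    rw [Nat.card_eq_fintype_card]
    exact hh
  exact CoatesSujatha2005.conjA_of_not_dvd_card_classGroup W (by decide) hG hh' hκ hc3

/-- **U₀ at a K9 row from door L6, class-number form** — `ord₃ #Ш(E) ≤ ord₃ #Ш(E)_an` (`MissingUpperBoundAt E 3`) for `E/ℚ` globally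
minimal with `r_an = 0`, `ClassO6 E 3`, `E[3]` irreducible, `Δ(E)` a cube, `3 ∤ h(ℚ(E[3]))` and `E(ℚ₃)[3] = 0`, modulo the named facts
`hKatoA` (Kato's Thm. 14.5 (3) in the fine-Selmer reading), `hGZK`, `hmod` ONLY: (A) by the fact-free door above, then k9-c4 g5's
`WildFineSelmerSupersingularCMAnchor.missingUpperBoundAt_wild_of_conjA`.  CONDITIONAL on the three displayed facts; nothing booked.
[cite: Kato2004Asterisque, Thm. 14.5 (3) (p. 236) and Prop. 14.16 (2)] [cite: CoatesSujatha2005, §3 Thm. 3.4]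
[cite: DeoRaySujatha2023, §3 Thm. 3.9 (b)] -/
theorem missingUpperBoundAt_three_of_Δ_eq_cube_of_not_dvd_classNumber
    (hKatoA : Kato2004.rankZero_padicValNat_sha_add_padicValNat_tamagawa_le_of_additive_potGood_of_irreducible_of_fineSelmerDual_fg)
    (hGZK : rank_eq_analyticRank_of_analyticRank_le_one) (hmod : hasEntireLFunction_rat)
    (W : WeierstrassCurve ℚ) [W.IsElliptic] [W.IsGloballyMinimal] [Fact (3 : ℕ).Prime]
    (hr : W.analyticRank = 0) (hO : ClassO6 W 3) (hirr : W.HasIrreducibleModPGaloisRep 3) {d : ℚ} (hΔ : W.Δ = d ^ 3)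
    (hh : haveI : NumberField ↥(W.divisionField 3) := NumberField.mk
      ¬ 3 ∣ NumberField.classNumber ↥(W.divisionField 3))
    (hc3 : ∀ v : HeightOneSpectrum (𝓞 ℚ), ((3 : ℕ) : 𝓞 ℚ) ∈ v.asIdeal →
      ∀ x : W.geomPrimaryTorsion 3, 3 • x = 0 → (∀ δ ∈ GreenbergSelmer.decomp v, δ • x = x) → x = 0) :
    MissingUpperBoundAt W 3 :=
  WildFineSelmerSupersingularCMAnchor.missingUpperBoundAt_wild_of_conjA hKatoA hGZK hmod W hr hO hirr
    (fun κ hκ => conjA_three_of_Δ_eq_cube_of_not_dvd_classNumber W hirr hΔ hh hc3 κ hκ)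

/-! ## APPEND (same seat, g24): the HOM-TRIVIAL form of door L6 — for rows with `3 ∣ h(ℚ(E[3]))` but no `E[3]` inside `Cl(ℚ(E[3])) ⊗ 𝔽₃`

For the 29 K9 rows of conjA-anchor g15's L6 census with `3 ∣ h(ℚ(E[3]))` and `m_ρ̄(Cl(ℚ(E[3]))/3) = 0` (kit j313355 `drsl1` at layer 0, convention
certificate j313432) the class-number entry point is silent; conjA-anchor g17's `CoatesSujatha2005.conjA_of_homTrivial_divisionField` takes instead
(c2*)₀ itself — «every `Γ_ℚ`-equivariant additive `Cl(𝓞_{ℚ(E[3])}) → E[3]` is zero» — as the displayed hypothesis.  Same (c1) discharge by a cube `Δ`. -/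

/-- **(A) at `(E, 3)` with NO named fact — door L6, hom-trivial form.**  `E[3]` irreducible, `Δ(E) = d³`, (c2*)₀ «every additive
`Γ_ℚ`-equivariant map `Cl(𝓞_{ℚ(E[3])}) → E[3]` vanishes» (numerically: the `E[3]`-isotypic part of `Cl(ℚ(E[3])) ⊗ 𝔽₃` is zero), and no non-zero
point of `E[3]` fixed by the decomposition group at `3` (`E(ℚ₃)[3] = 0`) ⟹ statement (A) for every cyclotomic `ℤ₃`-extension.  One call of
conjA-anchor g17's `CoatesSujatha2005.conjA_of_homTrivial_divisionField`.
[cite: CoatesSujatha2005, §3 Thm. 3.4, Lemma 3.8 and Cor. 3.6] [cite: DeoRaySujatha2023, §3 Thm. 3.8 (c2) (arXiv:2202.09937 p. 9)]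
[cite: Serre1972, §2.4 Prop. 15, §5.3] -/
theorem conjA_three_of_Δ_eq_cube_of_homTrivial (W : WeierstrassCurve ℚ) [W.IsElliptic]
    (hirr : W.HasIrreducibleModPGaloisRep 3) {d : ℚ} (hΔ : W.Δ = d ^ 3)
    (h0 : haveI : NumberField ↥(W.divisionField 3) := NumberField.mk
      ∀ μ : Additive (ClassGroup (𝓞 ↥(W.divisionField 3))) →+ geomTorsion W ((3 : ℕ) : ℤ),
        (∀ (τ : absoluteGaloisGroup ℚ) (c : ClassGroup (𝓞 ↥(W.divisionField 3))),
          μ (Additive.ofMul (ClassGroup.mulEquiv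
            (Literature.NumberTheory.NumberFields.AmbiguousClass.intAut (absRestrictNormalHom (W.divisionField 3) τ)) c)) = τ • μ (Additive.ofMul c)) →
        μ = 0)
    (hD : ∀ v : HeightOneSpectrum (𝓞 ℚ), ((3 : ℕ) : 𝓞 ℚ) ∈ v.asIdeal →
      ∀ x : geomTorsion W ((3 : ℕ) : ℤ), (∀ δ ∈ GreenbergSelmer.decomp v, δ • x = x) → x = 0)
    (κ : ZpExtension ℚ 3) (hκ : κ.IsCyclotomic) :
    ∃ (γ : absoluteGaloisGroup ℚ) (D : W.FineSelmerDualData κ γ),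
      Module.Finite ℤ_[3] (RestrictScalars ℤ_[3] (IwasawaAlgebra 3) D.X) := by
  haveI : Fact (Nat.Prime 3) := ⟨Nat.prime_three⟩
  haveI : NumberField ↥(W.divisionField 3) := NumberField.mk
  exact CoatesSujatha2005.conjA_of_homTrivial_divisionField W (by decide)
    (DivisionFieldFukudaDoor.not_dvd_card_aut_divisionField_three_of_Δ_eq_cube W hirr hΔ) hκ h0 hD

/-- **U₀ at a K9 row from door L6, hom-trivial form** — `MissingUpperBoundAt E 3` for `E/ℚ` globally minimal with `r_an = 0`, `ClassO6 E 3`,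
`E[3]` irreducible, `Δ(E)` a cube, (c2*)₀ and `E(ℚ₃)[3] = 0` as above, modulo `hKatoA hGZK hmod` ONLY (k9-c4 g5's
`WildFineSelmerSupersingularCMAnchor.missingUpperBoundAt_wild_of_conjA`). CONDITIONAL on the three displayed facts; nothing booked.
[cite: Kato2004Asterisque, Thm. 14.5 (3) (p. 236) and Prop. 14.16 (2)] [cite: CoatesSujatha2005, §3 Thm. 3.4]
[cite: DeoRaySujatha2023, §3 Thm. 3.8 (c2)] -/
theorem missingUpperBoundAt_three_of_Δ_eq_cube_of_homTrivial
    (hKatoA : Kato2004.rankZero_padicValNat_sha_add_padicValNat_tamagawa_le_of_additive_potGood_of_irreducible_of_fineSelmerDual_fg)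
    (hGZK : rank_eq_analyticRank_of_analyticRank_le_one) (hmod : hasEntireLFunction_rat)
    (W : WeierstrassCurve ℚ) [W.IsElliptic] [W.IsGloballyMinimal] [Fact (3 : ℕ).Prime]
    (hr : W.analyticRank = 0) (hO : ClassO6 W 3) (hirr : W.HasIrreducibleModPGaloisRep 3) {d : ℚ} (hΔ : W.Δ = d ^ 3)
    (h0 : haveI : NumberField ↥(W.divisionField 3) := NumberField.mk
      ∀ μ : Additive (ClassGroup (𝓞 ↥(W.divisionField 3))) →+ geomTorsion W ((3 : ℕ) : ℤ),
        (∀ (τ : absoluteGaloisGroup ℚ) (c : ClassGroup (𝓞 ↥(W.divisionField 3))),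
          μ (Additive.ofMul (ClassGroup.mulEquiv
            (Literature.NumberTheory.NumberFields.AmbiguousClass.intAut (absRestrictNormalHom (W.divisionField 3) τ)) c)) = τ • μ (Additive.ofMul c)) →
        μ = 0)
    (hD : ∀ v : HeightOneSpectrum (𝓞 ℚ), ((3 : ℕ) : 𝓞 ℚ) ∈ v.asIdeal →
      ∀ x : geomTorsion W ((3 : ℕ) : ℤ), (∀ δ ∈ GreenbergSelmer.decomp v, δ • x = x) → x = 0) :
    MissingUpperBoundAt W 3 :=
  WildFineSelmerSupersingularCMAnchor.missingUpperBoundAt_wild_of_conjA hKatoA hGZK hmod W hr hO hirr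
    (fun κ hκ => conjA_three_of_Δ_eq_cube_of_homTrivial W hirr hΔ h0 hD κ hκ)

end Summit.BirchSwinnertonDyer.BirchSwinnertonDyer.Theorems.WildFineSelmerClassNumberL6Door

end
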